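import Mathlib.Analysis.Calculus.Deriv.MeanValue
import Mathlib.Analysis.ODE.Gronwall
import Mathlib.Analysis.ODE.ExistUnique
import Mathlib.Analysis.SpecialFunctions.Complex.Log
import Literature.Probability.RandomPlanarGeometry.WholePlaneSLE
import Literature.Probability.RandomPlanarGeometry.RadialLoewnerChain
import HarnessLib

/-!
# The whole-plane Loewner equation: the backward flow through a point (exterior picture)

Topic `Probability/RandomPlanarGeometry`. First of three files
(`WholePlaneLoewnerBackwardFlow`, `…BackwardMaps`, `…BackwardChain`) proving the EXISTENCE half
of the named fact `WholePlaneLoewnerChain.exists_unique` of `WholePlaneSLE` (G. F. Lawler,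
*Conformally Invariant Processes in the Plane* (2005), §4.3, Prop. 4.21) by the **backward
Loewner flow in the exterior picture**: for a continuous driving angle `lam`, a time `t ∈ ℝ` and a
point `w` with `|w| > 1`, the solution `s ↦ orbit lam t w s` of the whole-plane Loewner equation
`u̇ = V(s, u)`, `V(s, z) = z (W_s + z)/(W_s - z)`, `W_s = exp (i lam s)` (`WholePlaneLoewner.field`,
Lawler's (4.24) with `e^{-iU} = W`), through `(t, w)`, exists for ALL `s ≤ t`; the inverse
Loewner map is then `F_t(w) = lim_{s → -∞} e^s orbit lam t w s` (sequel). This is Lawler's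
construction of Prop. 4.21 (`F_t = lim_{s → -∞} F_t^{(s)}` through the radial/backward flow,
Lemma 4.20) followed one point at a time, organised like the tree's chordal `LoewnerFlow`
(truncated field, one Picard–Lindelöf cylinder, truncation inactive). The uniqueness half of the
fact and its reduction to existence are `WholePlaneLoewnerChain.unique` /
`exists_unique_of_forall_nonempty` of `WholePlaneSLEProofs`; the sibling files
`WholePlaneLoewnerDefs` / `WholePlaneLoewnerVolterra` develop the complementary *interior*
picture `k = 1/g(1/·)` (there `WholePlaneLoewner.drivingPt = e^{-i lam} = conj (drivW lam)`); to
keep the two vocabularies apart everything here lives in the sub-namespace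
`WholePlaneLoewner.BackwardFlow`.

* Field algebra: `drivW lam s = W_s`, `|W_s| = 1`; partial fractions
  `V(s, z) = -z - 2W + 2W²/(W - z)` (`field_eq_partialFraction`); the exact difference identity
  `V(s, z₁) - V(s, z₂) = (z₁ - z₂) a`, `a = -1 + 2W²/((W - z₁)(W - z₂))` (`field_sub_field_eq`,
  `diffCoeff`), so `V(s, ·)` is `(1 + 2/δ²)`-Lipschitz on `{1 + δ ≤ |z|}` (`lipschitzOnWith_field`);
  the sign `Re (V(s, z)/z) = (1 - |z|²)/|W - z|² < 0` off the closed disc (`re_field_div_lt_zero`).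
* The conjugated unknown `h = e^s g`: `ḣ = hField (s, h) = 2 W e^s h/(W e^s - h)` (`hField_eq`),
  Lipschitz constant `O(e^{2s})` near a point (`norm_hField_sub_hField_le`), and
  `eqOn_of_tendsto_atBot`: **two solutions of `u̇ = V(s, u)` on `(-∞, t]` with `|uᵢ| > 1` and the
  same asymptotic initial value `e^s uᵢ(s) → z ≠ 0` coincide** (any `lam`; Grönwall from
  `a → -∞` with the a priori rate `|hᵢ(s) - z| ≤ 4e^s`, then `ODE_solution_unique`) — used in the
  sequel for the injectivity of `F_t`.
* Logarithmic coordinates `u = exp χ`: `χ̇ = logField (s, χ) = (p + 1)/(p - 1)`,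
  `p = exp (-χ + i lam s) = W/u` (`field_exp`), `|p| = e^{-Re χ} < 1` off the disc, real part
  `-(1 - |p|²)/|1 - p|² < 0` with two-sided bounds (`re_logField_bounds`), Lipschitz on half-planes
  `{Re χ ≥ ℓ}` (`norm_logField_sub_le`). Truncating the real part (`liftRe`, `truncField`) makes
  the field globally bounded and Lipschitz, so Mathlib's `IsPicardLindelof` solves it on every
  window `[t - T, t + 1]` (`exists_truncSol`, `truncSol_unique`); the windows patch to
  `(-∞, t + 1]` (`exists_globalTruncSol`) and, `Re χ` being decreasing, the truncation at level
  `(log |w|)/2` is inactive on `(-∞, t]`.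
* `logOrbit lam t w`, `orbit lam t w = exp ∘ logOrbit`: `orbit t w t = w`, `u̇ = V(s, u)` for
  `s ≤ t` (`hasDerivAt_orbit`) and slightly beyond (`exists_forward`), `|w| ≤ |orbit s|`
  increasing backward with `log |orbit s| ≥ log |w| + c_w (t - s)`, `c_w = (|w| - 1)/(|w| + 1)`
  (`re_logOrbit_ge`), backward uniqueness and the flow property
  `orbit t' (orbit t w t') = orbit t w` on `(-∞, t']` (`eqOn_of_eq`, `orbit_orbit`,
  `orbit_orbit_of_forward`).

Everything is proved; no named fact is introduced (D-0026).

## References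

* G. F. Lawler, *Conformally Invariant Processes in the Plane*, AMS (2005), §4.3, Lemma 4.20,
  Prop. 4.21 and eq. (4.24); §4.1 (the backward flow, proof of Thm. 4.6) [Lawler2005].

## Mathlib / tree

Mathlib: `dist_le_of_trajectories_ODE_of_mem`, `ODE_solution_unique_of_mem_Icc_right/left`,
`image_norm_le_of_norm_deriv_right_le_deriv_boundary'`, `IsPicardLindelof`,
`antitoneOn_of_hasDerivWithinAt_nonpos`, `Convex.norm_image_sub_le_of_norm_hasDerivWithin_le`,
`Complex.log`, `Complex.norm_exp`. Tree: `RadialLoewner.Disc.re_add_div_sub`.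
-/

noncomputable section

open Set Filter Metric Complex
open scoped Topology NNReal

namespace Literature.Probability.RandomPlanarGeometry

namespace WholePlaneLoewner.BackwardFlow

variable (lam : ℝ → ℝ)

/-! ### The driving point and the algebra of the field -/

/-- The **driving point** `W_s = exp (i · lam s)` of the whole-plane Loewner equation
(Lawler (2005), (4.24), with `e^{-iU_t} = W_t`). [cite: Lawler2005, §4.3 eq. (4.24)] -/
def drivW (s : ℝ) : ℂ := exp (lam s * I)

/-- Unfolding lemma for the driving point. [folklore] -/
theorem drivW_apply (s : ℝ) : drivW lam s = exp (lam s * I) := rfl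

/-- The driving point lies on the unit circle. [folklore] -/
@[simp] theorem norm_drivW (s : ℝ) : ‖drivW lam s‖ = 1 := by
  rw [drivW_apply, Complex.norm_exp_ofReal_mul_I]

/-- `|W_s|² = 1`. [folklore] -/
theorem normSq_drivW (s : ℝ) : Complex.normSq (drivW lam s) = 1 := by
  rw [← Complex.sq_norm, norm_drivW, one_pow]

/-- The driving point is non-zero. [folklore] -/
theorem drivW_ne_zero (s : ℝ) : drivW lam s ≠ 0 :=
  norm_pos_iff.1 (by rw [norm_drivW]; exact one_pos)

/-- The driving point is continuous in time for a continuous driving angle. [folklore] -/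
theorem continuous_drivW {lam : ℝ → ℝ} (hlam : Continuous lam) :
    Continuous (drivW lam) := by
  unfold drivW
  fun_prop

/-- The field in terms of the driving point: `V(s, z) = z (W + z)/(W - z)`. [folklore] -/
theorem field_eq (s : ℝ) (z : ℂ) :
    field lam s z = z * (drivW lam s + z) / (drivW lam s - z) := rfl

/-- A point outside the closed unit disc is at distance at least `|z| - 1 > 0` from the driving
point. [folklore] -/
theorem norm_sub_one_le_norm_drivW_sub (s : ℝ) (z : ℂ) :
    ‖z‖ - 1 ≤ ‖drivW lam s - z‖ := by
  have h := norm_sub_norm_le z (drivW lam s)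
  rw [norm_drivW, ← norm_neg (z - drivW lam s), neg_sub] at h
  linarith

/-- Outside the closed unit disc the denominator `W - z` does not vanish. [folklore] -/
theorem drivW_sub_ne_zero {s : ℝ} {z : ℂ} (hz : 1 < ‖z‖) : drivW lam s - z ≠ 0 :=
  norm_pos_iff.1 (lt_of_lt_of_le (by linarith) (norm_sub_one_le_norm_drivW_sub lam s z))

/-- **Partial fractions**: `V(s, z) = -z - 2W + 2W²/(W - z)` off the singularity. [folklore] -/
theorem field_eq_partialFraction {s : ℝ} {z : ℂ} (hz : drivW lam s - z ≠ 0) :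
    field lam s z = -z - 2 * drivW lam s + 2 * drivW lam s ^ 2 / (drivW lam s - z) := by
  rw [field_eq]
  field_simp
  ring

/-- The coefficient of the **difference identity** `V(s, z₁) - V(s, z₂) = (z₁ - z₂) a(s, z₁, z₂)`:
`a = -1 + 2W²/((W - z₁)(W - z₂))` (Lawler (2005), proof of Prop. 4.21 / eq. (4.7) in the radial
form). [folklore] -/
def diffCoeff (s : ℝ) (z₁ z₂ : ℂ) : ℂ :=
  -1 + 2 * drivW lam s ^ 2 / ((drivW lam s - z₁) * (drivW lam s - z₂))

/-- Unfolding lemma for `diffCoeff`. [folklore] -/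
theorem diffCoeff_apply (s : ℝ) (z₁ z₂ : ℂ) : diffCoeff lam s z₁ z₂ =
    -1 + 2 * drivW lam s ^ 2 / ((drivW lam s - z₁) * (drivW lam s - z₂)) := rfl

/-- `diffCoeff` is symmetric. [folklore] -/
theorem diffCoeff_comm (s : ℝ) (z₁ z₂ : ℂ) : diffCoeff lam s z₁ z₂ = diffCoeff lam s z₂ z₁ := by
  rw [diffCoeff_apply, diffCoeff_apply, mul_comm (drivW lam s - z₁)]

/-- **Difference identity**: `V(s, z₁) - V(s, z₂) = (z₁ - z₂) · a(s, z₁, z₂)`. [folklore] -/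
theorem field_sub_field_eq {s : ℝ} {z₁ z₂ : ℂ} (h₁ : drivW lam s - z₁ ≠ 0)
    (h₂ : drivW lam s - z₂ ≠ 0) :
    field lam s z₁ - field lam s z₂ = (z₁ - z₂) * diffCoeff lam s z₁ z₂ := by
  rw [field_eq_partialFraction lam h₁, field_eq_partialFraction lam h₂, diffCoeff_apply]
  field_simp
  ring

/-- Bound on the difference coefficient outside the disc:
`|a(s, z₁, z₂)| ≤ 1 + 2/((|z₁| - 1)(|z₂| - 1))`. [folklore] -/
theorem norm_diffCoeff_le {s : ℝ} {z₁ z₂ : ℂ} (h₁ : 1 < ‖z₁‖) (h₂ : 1 < ‖z₂‖) :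
    ‖diffCoeff lam s z₁ z₂‖ ≤ 1 + 2 / ((‖z₁‖ - 1) * (‖z₂‖ - 1)) := by
  rw [diffCoeff_apply]
  refine (norm_add_le _ _).trans ?_
  rw [norm_neg, norm_one, norm_div, norm_mul, norm_pow, norm_drivW, one_pow,
    Complex.norm_two, mul_one, norm_mul]
  have hprod : (‖z₁‖ - 1) * (‖z₂‖ - 1) ≤ ‖drivW lam s - z₁‖ * ‖drivW lam s - z₂‖ :=
    mul_le_mul (norm_sub_one_le_norm_drivW_sub lam s z₁)
      (norm_sub_one_le_norm_drivW_sub lam s z₂) (by linarith) (norm_nonneg _)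
  have hpos : 0 < (‖z₁‖ - 1) * (‖z₂‖ - 1) := mul_pos (by linarith) (by linarith)
  exact add_le_add_right (div_le_div_of_nonneg_left (by norm_num : (0 : ℝ) ≤ 2) hpos hprod) 1

/-- **The field is Lipschitz away from the closed unit disc**: on `{z | 1 + δ ≤ |z|}` the map
`V(s, ·)` is `(1 + 2/δ²)`-Lipschitz (no convexity needed: the difference identity is exact).
[folklore] -/
theorem lipschitzOnWith_field (s : ℝ) {δ : ℝ≥0} (hδ : 0 < δ) :
    LipschitzOnWith (1 + 2 / δ ^ 2) (field lam s) {z : ℂ | 1 + (δ : ℝ) ≤ ‖z‖} := by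
  have hδ' : (0 : ℝ) < δ := hδ
  refine LipschitzOnWith.of_dist_le_mul fun z₁ hz₁ z₂ hz₂ ↦ ?_
  have hz₁' : 1 < ‖z₁‖ := by have := hz₁.out; linarith
  have hz₂' : 1 < ‖z₂‖ := by have := hz₂.out; linarith
  rw [dist_eq_norm, dist_eq_norm, field_sub_field_eq lam (drivW_sub_ne_zero lam hz₁')
    (drivW_sub_ne_zero lam hz₂'), norm_mul, mul_comm]
  gcongr
  refine (norm_diffCoeff_le lam hz₁' hz₂').trans ?_
  push_cast
  gcongr 1 + ?_
  rw [sq]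
  refine div_le_div_of_nonneg_left (by norm_num) (mul_pos hδ' hδ') ?_
  exact mul_le_mul (by linarith [hz₁.out]) (by linarith [hz₂.out]) hδ'.le (by linarith [hz₁.out])

/-- The **sign of the radial component**: `Re (V(s, z)/z) = Re ((W + z)/(W - z))
= (1 - |z|²)/|W - z|²`. [folklore] -/
theorem re_field_div (s : ℝ) (z : ℂ) :
    ((drivW lam s + z) / (drivW lam s - z)).re =
      (1 - Complex.normSq z) / Complex.normSq (drivW lam s - z) :=
  RadialLoewner.Disc.re_add_div_sub (normSq_drivW lam s)

/-- Outside the closed unit disc the radial component of the field points inward: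
`Re ((W + z)/(W - z)) < 0` for `|z| > 1`. [folklore] -/
theorem re_field_div_lt_zero (s : ℝ) {z : ℂ} (hz : 1 < ‖z‖) :
    ((drivW lam s + z) / (drivW lam s - z)).re < 0 := by
  rw [re_field_div]
  refine div_neg_of_neg_of_pos ?_ ?_
  · rw [Complex.normSq_eq_norm_sq]
    nlinarith
  · exact Complex.normSq_pos.2 (drivW_sub_ne_zero lam hz)

/-! ### The conjugated unknown `h = e^s g` -/

/-- The **conjugated field**: `hField lam s x = x + e^s V(s, e^{-s} x)`, the vector field of
`h_s = e^s g_s` when `ġ = V(s, g)`. [folklore] -/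
def hField (s : ℝ) (x : ℂ) : ℂ :=
  x + (Real.exp s : ℂ) * field lam s ((Real.exp (-s) : ℂ) * x)

/-- Unfolding lemma for `hField`. [folklore] -/
theorem hField_apply (s : ℝ) (x : ℂ) :
    hField lam s x = x + (Real.exp s : ℂ) * field lam s ((Real.exp (-s) : ℂ) * x) := rfl

/-- If `ġ = V(s, g)` at `s` then `h = e^s g` satisfies `ḣ = hField (s, h)` at `s`. [folklore] -/
theorem hasDerivAt_exp_mul {u : ℝ → ℂ} {s : ℝ} (hu : HasDerivAt u (field lam s (u s)) s) :
    HasDerivAt (fun r ↦ (Real.exp r : ℂ) * u r) (hField lam s ((Real.exp s : ℂ) * u s)) s := by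
  have he : HasDerivAt (fun r : ℝ ↦ (Real.exp r : ℂ)) (Real.exp s : ℂ) s := by
    simpa using (Real.hasDerivAt_exp s).ofReal_comp
  have h := he.mul hu
  have heq : (Real.exp (-s) : ℂ) * ((Real.exp s : ℂ) * u s) = u s := by
    rw [← mul_assoc, ← Complex.ofReal_mul, Real.exp_neg, inv_mul_cancel₀ (Real.exp_pos s).ne',
      Complex.ofReal_one, one_mul]
  rw [hField_apply, heq]
  exact h

/-- Closed form of the conjugated field: `hField (s, x) = 2 W e^s x/(W e^s - x)` off the
singularity `x = W e^s`. [folklore] -/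
theorem hField_eq {s : ℝ} {x : ℂ} (hx : drivW lam s * (Real.exp s : ℂ) - x ≠ 0) :
    hField lam s x =
      2 * drivW lam s * (Real.exp s : ℂ) * x / (drivW lam s * (Real.exp s : ℂ) - x) := by
  have he : (Real.exp s : ℂ) ≠ 0 := Complex.ofReal_ne_zero.2 (Real.exp_pos s).ne'
  have hes : (Real.exp (-s) : ℂ) = (Real.exp s : ℂ)⁻¹ := by
    rw [Real.exp_neg, Complex.ofReal_inv]
  set E : ℂ := (Real.exp s : ℂ) with hE
  set W : ℂ := drivW lam s with hW
  have hden : W - E⁻¹ * x = E⁻¹ * (W * E - x) := by field_simp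
  have h1 : E * (E⁻¹ * x * (W + E⁻¹ * x) / (W - E⁻¹ * x)) = x * (W * E + x) / (W * E - x) := by
    rw [hden]
    field_simp
  rw [hField_apply, field_eq, hes, h1, eq_div_iff hx, add_mul, div_mul_cancel₀ _ hx]
  ring

/-- **Difference identity for the conjugated field**:
`hField (s, x) - hField (s, y) = (x - y) · 2 W² e^{2s}/((W e^s - x)(W e^s - y))`. [folklore] -/
theorem hField_sub_hField {s : ℝ} {x y : ℂ} (hx : drivW lam s * (Real.exp s : ℂ) - x ≠ 0)
    (hy : drivW lam s * (Real.exp s : ℂ) - y ≠ 0) :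
    hField lam s x - hField lam s y = (x - y) * (2 * drivW lam s ^ 2 * (Real.exp s : ℂ) ^ 2 /
      ((drivW lam s * (Real.exp s : ℂ) - x) * (drivW lam s * (Real.exp s : ℂ) - y))) := by
  rw [hField_eq lam hx, hField_eq lam hy]
  field_simp
  ring

/-- Norm of the conjugated field: `|hField (s, x)| = 2 e^s |x|/|W e^s - x|`. [folklore] -/
theorem norm_hField {s : ℝ} {x : ℂ} (hx : drivW lam s * (Real.exp s : ℂ) - x ≠ 0) :
    ‖hField lam s x‖ = 2 * Real.exp s * ‖x‖ / ‖drivW lam s * (Real.exp s : ℂ) - x‖ := by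
  rw [hField_eq lam hx, norm_div, norm_mul, norm_mul, norm_mul, norm_drivW, Complex.norm_two,
    Complex.norm_real, Real.norm_eq_abs, abs_of_pos (Real.exp_pos s), mul_one]

/-- The distance from `x` to the singular point `W e^s` is at least `|x| - e^s`. [folklore] -/
theorem norm_sub_exp_le {s : ℝ} (x : ℂ) :
    ‖x‖ - Real.exp s ≤ ‖drivW lam s * (Real.exp s : ℂ) - x‖ := by
  have h := norm_sub_norm_le x (drivW lam s * (Real.exp s : ℂ))
  rw [norm_mul, norm_drivW, one_mul, Complex.norm_real, Real.norm_eq_abs,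
    abs_of_pos (Real.exp_pos s), ← norm_neg (x - _), neg_sub] at h
  linarith

/-- **Lipschitz estimate for the conjugated field**: if `|W e^s - x|, |W e^s - y| ≥ m > 0` then
`|hField (s, x) - hField (s, y)| ≤ (2 e^{2s}/m²) |x - y|`. [folklore] -/
theorem norm_hField_sub_hField_le {s : ℝ} {x y : ℂ} {m : ℝ} (hm : 0 < m)
    (hx : m ≤ ‖drivW lam s * (Real.exp s : ℂ) - x‖)
    (hy : m ≤ ‖drivW lam s * (Real.exp s : ℂ) - y‖) :
    ‖hField lam s x - hField lam s y‖ ≤ 2 * Real.exp s ^ 2 / m ^ 2 * ‖x - y‖ := by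
  have hx0 : drivW lam s * (Real.exp s : ℂ) - x ≠ 0 := norm_pos_iff.1 (hm.trans_le hx)
  have hy0 : drivW lam s * (Real.exp s : ℂ) - y ≠ 0 := norm_pos_iff.1 (hm.trans_le hy)
  rw [hField_sub_hField lam hx0 hy0, norm_mul, mul_comm]
  gcongr
  rw [norm_div, norm_mul, norm_mul, norm_pow, norm_pow, norm_drivW, one_pow, mul_one,
    Complex.norm_two, Complex.norm_real, Real.norm_eq_abs, abs_of_pos (Real.exp_pos s), norm_mul]
  have hprod : m ^ 2 ≤ ‖drivW lam s * (Real.exp s : ℂ) - x‖ *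
      ‖drivW lam s * (Real.exp s : ℂ) - y‖ := by
    rw [sq]; exact mul_le_mul hx hy hm.le (norm_nonneg _)
  exact div_le_div_of_nonneg_left (by positivity) (by positivity) hprod

/-! ### Uniqueness of solutions started at `t = -∞` -/

section Uniqueness

variable {lam}
variable {u : ℝ → ℂ} {t : ℝ} {z : ℂ}

/-- The conjugated trajectory `h_s = e^s u_s` of a solution `u` of `u̇ = V(s, u)` on `(-∞, t]`
solves `ḣ = hField (s, h)` there. [folklore] -/
theorem hasDerivAt_conj_of_le (hd : ∀ s ≤ t, HasDerivAt u (field lam s (u s)) s) {s : ℝ}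
    (hs : s ≤ t) :
    HasDerivAt (fun r ↦ (Real.exp r : ℂ) * u r)
      (hField lam s ((Real.exp s : ℂ) * u s)) s :=
  hasDerivAt_exp_mul lam (hd s hs)

/-- Along a solution outside the closed unit disc, `|W e^s - h_s| ≥ e^s (|u_s| - 1) > 0`.
[folklore] -/
theorem exp_mul_norm_sub_one_le (s : ℝ) (x : ℂ) :
    Real.exp s * (‖x‖ - 1) ≤ ‖drivW lam s * (Real.exp s : ℂ) - (Real.exp s : ℂ) * x‖ := by
  have h := norm_sub_exp_le lam (s := s) ((Real.exp s : ℂ) * x)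
  rw [norm_mul, Complex.norm_real, Real.norm_eq_abs, abs_of_pos (Real.exp_pos s)] at h
  linarith

/-- **A priori decay of the conjugated field near `-∞`.** If `|x - z| ≤ |z|/4` and
`e^s ≤ |z|/8` then `|W e^s - x| ≥ 5|z|/8` and `|hField (s, x)| ≤ 4 e^s`. [folklore] -/
theorem norm_hField_le_of_mem_closedBall (hz : z ≠ 0) {s : ℝ} (hs : Real.exp s ≤ ‖z‖ / 8)
    {x : ℂ} (hx : x ∈ closedBall z (‖z‖ / 4)) :
    5 * ‖z‖ / 8 ≤ ‖drivW lam s * (Real.exp s : ℂ) - x‖ ∧ ‖hField lam s x‖ ≤ 4 * Real.exp s := by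
  have hz' : 0 < ‖z‖ := norm_pos_iff.2 hz
  rw [mem_closedBall, dist_eq_norm] at hx
  have hxlow : 3 * ‖z‖ / 4 ≤ ‖x‖ := by
    have := norm_sub_norm_le z x
    rw [← norm_neg (z - x), neg_sub] at this
    linarith
  have hxup : ‖x‖ ≤ 5 * ‖z‖ / 4 := by
    have := norm_le_norm_add_norm_sub' x z
    linarith
  have hden : 5 * ‖z‖ / 8 ≤ ‖drivW lam s * (Real.exp s : ℂ) - x‖ :=
    le_trans (by linarith) (norm_sub_exp_le lam (s := s) x)
  refine ⟨hden, ?_⟩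
  have hden0 : drivW lam s * (Real.exp s : ℂ) - x ≠ 0 :=
    norm_pos_iff.1 (lt_of_lt_of_le (by positivity) hden)
  rw [norm_hField lam hden0, div_le_iff₀ (lt_of_lt_of_le (by positivity) hden)]
  have hes := Real.exp_pos s
  nlinarith

/-- **Rate of convergence at `-∞`.** If `h` solves `ḣ = hField (s, h)` on `(-∞, s₁]`, tends to
`z ≠ 0` at `-∞`, stays in the ball `|h - z| ≤ |z|/4` on `(-∞, s₁]` and `e^{s₁} ≤ |z|/8`, then
`|h(b) - z| ≤ 4 e^b` for every `b ≤ s₁`. [folklore] -/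
theorem norm_sub_lim_le {h : ℝ → ℂ} {s₁ : ℝ} (hz : z ≠ 0) (hs₁ : Real.exp s₁ ≤ ‖z‖ / 8)
    (hd : ∀ s ≤ s₁, HasDerivAt h (hField lam s (h s)) s)
    (hball : ∀ s ≤ s₁, h s ∈ closedBall z (‖z‖ / 4))
    (hlim : Tendsto h atBot (𝓝 z)) {b : ℝ} (hb : b ≤ s₁) : ‖h b - z‖ ≤ 4 * Real.exp b := by
  -- `|h b - h a| ≤ 4 (e^b - e^a)` for `a ≤ b`
  have hstep : ∀ a ≤ b, ‖h b - h a‖ ≤ 4 * (Real.exp b - Real.exp a) := by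
    intro a hab
    have hcont : ContinuousOn (fun x ↦ h x - h a) (Icc a b) := fun x hx ↦
      ((hd x (hx.2.trans hb)).continuousAt.sub continuousAt_const).continuousWithinAt
    have hderiv : ∀ x ∈ Ico a b, HasDerivWithinAt (fun x ↦ h x - h a) (hField lam x (h x)) (Ici x) x :=
      fun x hx ↦ ((hd x (hx.2.le.trans hb)).sub_const (h a)).hasDerivWithinAt
    have hB : ContinuousOn (fun x ↦ 4 * (Real.exp x - Real.exp a)) (Icc a b) := by fun_prop
    have hB' : ∀ x ∈ Ico a b, HasDerivWithinAt (fun x ↦ 4 * (Real.exp x - Real.exp a))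
        (4 * Real.exp x) (Ici x) x := fun x _ ↦ by
      simpa using (((Real.hasDerivAt_exp x).sub_const (Real.exp a)).const_mul 4).hasDerivWithinAt
    have hbound : ∀ x ∈ Ico a b, ‖hField lam x (h x)‖ ≤ 4 * Real.exp x := fun x hx ↦
      (norm_hField_le_of_mem_closedBall hz ((Real.exp_le_exp.2 (hx.2.le.trans hb)).trans hs₁)
        (hball x (hx.2.le.trans hb))).2
    have := image_norm_le_of_norm_deriv_right_le_deriv_boundary' hcont hderiv (by simp) hB hB'
      hbound (right_mem_Icc.2 hab)
    simpa using this
  -- let `a → -∞`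
  have hlim' : Tendsto (fun a ↦ ‖h b - h a‖) atBot (𝓝 ‖h b - z‖) :=
    (continuous_norm.tendsto _).comp (tendsto_const_nhds.sub hlim)
  have hlim'' : Tendsto (fun a ↦ 4 * (Real.exp b - Real.exp a)) atBot (𝓝 (4 * (Real.exp b - 0))) :=
    (tendsto_const_nhds.sub Real.tendsto_exp_atBot).const_mul 4
  rw [sub_zero] at hlim''
  exact le_of_tendsto_of_tendsto hlim' hlim'' (eventually_atBot.2 ⟨b, hstep⟩)

/-- **Uniqueness of the solution started at `-∞`** (Lawler (2005), Prop. 4.21, uniqueness for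
one point). Let `u₁, u₂` solve the whole-plane Loewner equation `u̇ = V(s, u)` on `(-∞, t]`,
stay outside the closed unit disc there, and have the same asymptotic initial value
`e^s uᵢ(s) → z ≠ 0` as `s → -∞`. Then `u₁ = u₂` on `(-∞, t]`. No continuity of the driving angle
is required. [cite: Lawler2005, §4.3 Prop. 4.21] -/
theorem eqOn_of_tendsto_atBot {u₁ u₂ : ℝ → ℂ} (hz : z ≠ 0)
    (hd₁ : ∀ s ≤ t, HasDerivAt u₁ (field lam s (u₁ s)) s)
    (hd₂ : ∀ s ≤ t, HasDerivAt u₂ (field lam s (u₂ s)) s)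
    (hn₁ : ∀ s ≤ t, 1 < ‖u₁ s‖) (hn₂ : ∀ s ≤ t, 1 < ‖u₂ s‖)
    (hl₁ : Tendsto (fun s ↦ (Real.exp s : ℂ) * u₁ s) atBot (𝓝 z))
    (hl₂ : Tendsto (fun s ↦ (Real.exp s : ℂ) * u₂ s) atBot (𝓝 z)) :
    ∀ s ≤ t, u₁ s = u₂ s := by
  have hz' : 0 < ‖z‖ := norm_pos_iff.2 hz
  set h₁ : ℝ → ℂ := fun r ↦ (Real.exp r : ℂ) * u₁ r with hh₁
  set h₂ : ℝ → ℂ := fun r ↦ (Real.exp r : ℂ) * u₂ r with hh₂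
  have hd₁' : ∀ s ≤ t, HasDerivAt h₁ (hField lam s (h₁ s)) s := fun s hs ↦
    hasDerivAt_conj_of_le hd₁ hs
  have hd₂' : ∀ s ≤ t, HasDerivAt h₂ (hField lam s (h₂ s)) s := fun s hs ↦
    hasDerivAt_conj_of_le hd₂ hs
  -- it suffices to identify the conjugated trajectories
  suffices H : ∀ s ≤ t, h₁ s = h₂ s by
    intro s hs
    have := H s hs
    simp only [hh₁, hh₂] at this
    exact mul_left_cancel₀ (Complex.ofReal_ne_zero.2 (Real.exp_pos s).ne') this
  -- Step 1: a time `s₁ ≤ t` before which both stay in the ball `|h - z| ≤ |z|/4`, `e^{s₁} ≤ |z|/8`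
  obtain ⟨s₁, hs₁t, hs₁e, hb₁, hb₂⟩ : ∃ s₁ ≤ t, Real.exp s₁ ≤ ‖z‖ / 8 ∧
      (∀ s ≤ s₁, h₁ s ∈ closedBall z (‖z‖ / 4)) ∧ (∀ s ≤ s₁, h₂ s ∈ closedBall z (‖z‖ / 4)) := by
    have hball : closedBall z (‖z‖ / 4) ∈ 𝓝 z := closedBall_mem_nhds z (by positivity)
    have he : ∀ᶠ s in atBot, Real.exp s ≤ ‖z‖ / 8 :=
      (Real.tendsto_exp_atBot.eventually (ge_mem_nhds (by positivity : (0 : ℝ) < ‖z‖ / 8)))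
    obtain ⟨s₀, hs₀⟩ := eventually_atBot.1 ((hl₁.eventually_mem hball).and
      ((hl₂.eventually_mem hball).and (he.and (eventually_le_atBot t))))
    exact ⟨s₀, (hs₀ s₀ le_rfl).2.2.2, (hs₀ s₀ le_rfl).2.2.1, fun s hs ↦ (hs₀ s hs).1,
      fun s hs ↦ (hs₀ s hs).2.1⟩
  -- Step 2: `h₁ = h₂` on `(-∞, s₁]` by Grönwall from `a → -∞`
  have hK : ∀ s ≤ s₁, LipschitzOnWith (1 / 8 : ℝ≥0) (hField lam s) (closedBall z (‖z‖ / 4)) := by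
    intro s hs
    have hes : Real.exp s ≤ ‖z‖ / 8 := (Real.exp_le_exp.2 hs).trans hs₁e
    refine LipschitzOnWith.of_dist_le_mul fun x hx y hy ↦ ?_
    rw [dist_eq_norm, dist_eq_norm]
    have h5 : (0 : ℝ) < 5 * ‖z‖ / 8 := by positivity
    refine (norm_hField_sub_hField_le lam h5 (norm_hField_le_of_mem_closedBall hz hes hx).1
      (norm_hField_le_of_mem_closedBall hz hes hy).1).trans ?_
    gcongr
    rw [div_le_iff₀ (by positivity)]
    push_cast
    nlinarith [Real.exp_pos s, sq_nonneg (Real.exp s), sq_nonneg ‖z‖]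
  have hEq₁ : ∀ s ≤ s₁, h₁ s = h₂ s := by
    intro b hb
    -- Grönwall on `[a, b]` for every `a ≤ b`
    have hgr : ∀ a ≤ b, dist (h₁ b) (h₂ b) ≤ 8 * Real.exp a * Real.exp ((1 / 8 : ℝ≥0) * (b - a)) := by
      intro a hab
      have hδ : dist (h₁ a) (h₂ a) ≤ 8 * Real.exp a := by
        have e₁ := norm_sub_lim_le hz hs₁e (fun s hs ↦ hd₁' s (hs.trans hs₁t)) hb₁ hl₁ (hab.trans hb)
        have e₂ := norm_sub_lim_le hz hs₁e (fun s hs ↦ hd₂' s (hs.trans hs₁t)) hb₂ hl₂ (hab.trans hb)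
        calc dist (h₁ a) (h₂ a) ≤ ‖h₁ a - z‖ + ‖h₂ a - z‖ := by
              rw [dist_eq_norm, ← norm_neg (h₂ a - z)]
              exact le_trans (by rw [neg_sub, sub_add_sub_cancel]) (norm_add_le _ _)
          _ ≤ 8 * Real.exp a := by linarith
      exact dist_le_of_trajectories_ODE_of_mem (v := hField lam) (s := fun _ ↦ closedBall z (‖z‖ / 4))
        (K := 1 / 8) (f := h₁) (g := h₂) (a := a) (b := b) (δ := 8 * Real.exp a)
        (fun s hs ↦ hK s (hs.2.le.trans hb))
        (fun s hs ↦ (hd₁' s ((hs.2.trans hb).trans hs₁t)).continuousAt.continuousWithinAt)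
        (fun s hs ↦ (hd₁' s ((hs.2.le.trans hb).trans hs₁t)).hasDerivWithinAt)
        (fun s hs ↦ hb₁ s (hs.2.le.trans hb))
        (fun s hs ↦ (hd₂' s ((hs.2.trans hb).trans hs₁t)).continuousAt.continuousWithinAt)
        (fun s hs ↦ (hd₂' s ((hs.2.le.trans hb).trans hs₁t)).hasDerivWithinAt)
        (fun s hs ↦ hb₂ s (hs.2.le.trans hb)) hδ b (right_mem_Icc.2 hab)
    -- the bound tends to `0` as `a → -∞`
    have hto : Tendsto (fun a ↦ 8 * Real.exp a * Real.exp ((1 / 8 : ℝ≥0) * (b - a))) atBot (𝓝 0) := by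
      have heq : ∀ a, 8 * Real.exp a * Real.exp ((1 / 8 : ℝ≥0) * (b - a)) =
          8 * Real.exp (b / 8) * Real.exp ((7 / 8) * a) := by
        intro a
        simp only [NNReal.coe_div, NNReal.coe_one, NNReal.coe_ofNat]
        rw [mul_assoc, mul_assoc, ← Real.exp_add, ← Real.exp_add]
        congr 2
        ring
      simp_rw [heq]
      have : Tendsto (fun a ↦ Real.exp ((7 / 8) * a)) atBot (𝓝 0) :=
        Real.tendsto_exp_atBot.comp (tendsto_id.const_mul_atBot (by norm_num))
      simpa using this.const_mul (8 * Real.exp (b / 8))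
    have h0 : dist (h₁ b) (h₂ b) ≤ 0 :=
      le_of_tendsto_of_tendsto tendsto_const_nhds hto (eventually_atBot.2 ⟨b, hgr⟩)
    exact dist_le_zero.1 h0
  -- Step 3: from `s₁` to `t` by uniqueness with a Lipschitz field on `{|x| ≥ e^r + m}`
  intro s hs
  rcases le_or_gt s s₁ with hss₁ | hss₁
  · exact hEq₁ s hss₁
  -- a uniform margin `m > 0` with `|hᵢ r| ≥ e^r + m` on `[s₁, t]`
  obtain ⟨m, hm, hfar⟩ : ∃ m : ℝ, 0 < m ∧ ∀ r ∈ Icc s₁ t,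
      Real.exp r + m ≤ ‖h₁ r‖ ∧ Real.exp r + m ≤ ‖h₂ r‖ := by
    set φ : ℝ → ℝ := fun r ↦ min (‖h₁ r‖ - Real.exp r) (‖h₂ r‖ - Real.exp r) with hφ
    have hφc : ContinuousOn φ (Icc s₁ t) := by
      refine ContinuousOn.inf ?_ ?_
      · exact fun r hr ↦ (((hd₁' r hr.2).continuousAt.norm).sub
          (Real.continuous_exp.continuousAt)).continuousWithinAt
      · exact fun r hr ↦ (((hd₂' r hr.2).continuousAt.norm).sub
          (Real.continuous_exp.continuousAt)).continuousWithinAt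
    obtain ⟨r₀, hr₀, hmin⟩ := (isCompact_Icc (a := s₁) (b := t)).exists_isMinOn
      (nonempty_Icc.2 hs₁t) hφc
    have hpos : ∀ r ∈ Icc s₁ t, 0 < φ r := by
      intro r hr
      have e₁ : Real.exp r < ‖h₁ r‖ := by
        simp only [hh₁, norm_mul, Complex.norm_real, Real.norm_eq_abs, abs_of_pos (Real.exp_pos r)]
        exact lt_mul_of_one_lt_right (Real.exp_pos r) (hn₁ r hr.2)
      have e₂ : Real.exp r < ‖h₂ r‖ := by
        simp only [hh₂, norm_mul, Complex.norm_real, Real.norm_eq_abs, abs_of_pos (Real.exp_pos r)]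
        exact lt_mul_of_one_lt_right (Real.exp_pos r) (hn₂ r hr.2)
      exact lt_min (by linarith) (by linarith)
    refine ⟨φ r₀, hpos r₀ hr₀, fun r hr ↦ ?_⟩
    have h1 : φ r₀ ≤ φ r := hmin hr
    have h2 : φ r ≤ ‖h₁ r‖ - Real.exp r := min_le_left _ _
    have h3 : φ r ≤ ‖h₂ r‖ - Real.exp r := min_le_right _ _
    constructor <;> linarith
  have hLip : ∀ r ∈ Ico s₁ t, LipschitzOnWith (2 * Real.exp t ^ 2 / m ^ 2).toNNReal
      (hField lam r) {x : ℂ | Real.exp r + m ≤ ‖x‖} := by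
    intro r hr
    refine LipschitzOnWith.of_dist_le_mul fun x hx y hy ↦ ?_
    rw [dist_eq_norm, dist_eq_norm, Real.coe_toNNReal _ (by positivity)]
    have hx' : m ≤ ‖drivW lam r * (Real.exp r : ℂ) - x‖ :=
      le_trans (by have := hx.out; linarith) (norm_sub_exp_le lam (s := r) x)
    have hy' : m ≤ ‖drivW lam r * (Real.exp r : ℂ) - y‖ :=
      le_trans (by have := hy.out; linarith) (norm_sub_exp_le lam (s := r) y)
    refine (norm_hField_sub_hField_le lam hm hx' hy').trans ?_
    gcongr
    exact hr.2.le
  have key := ODE_solution_unique_of_mem_Icc_right (v := hField lam)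
    (s := fun r ↦ {x : ℂ | Real.exp r + m ≤ ‖x‖}) (f := h₁) (g := h₂) (a := s₁) (b := t) hLip
    (fun r hr ↦ (hd₁' r hr.2).continuousAt.continuousWithinAt)
    (fun r hr ↦ (hd₁' r hr.2.le).hasDerivWithinAt) (fun r hr ↦ (hfar r ⟨hr.1, hr.2.le⟩).1)
    (fun r hr ↦ (hd₂' r hr.2).continuousAt.continuousWithinAt)
    (fun r hr ↦ (hd₂' r hr.2.le).hasDerivWithinAt) (fun r hr ↦ (hfar r ⟨hr.1, hr.2.le⟩).2)
    (hEq₁ s₁ le_rfl)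
  exact key ⟨hss₁.le, hs⟩

end Uniqueness



/-! ### Logarithmic coordinates -/

/-- The quotient `p = W_s / u = exp (-χ + i lam s)` in logarithmic coordinates `u = exp χ`.
[folklore] -/
def pTerm (s : ℝ) (χ : ℂ) : ℂ := exp (-χ + lam s * I)

/-- Unfolding lemma for `pTerm`. [folklore] -/
theorem pTerm_apply (s : ℝ) (χ : ℂ) : pTerm lam s χ = exp (-χ + lam s * I) := rfl

/-- `p = W / exp χ`. [folklore] -/
theorem pTerm_eq (s : ℝ) (χ : ℂ) : pTerm lam s χ = drivW lam s * (exp χ)⁻¹ := by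
  rw [pTerm_apply, Complex.exp_add, drivW_apply, Complex.exp_neg, mul_comm]

/-- `|p| = e^{-Re χ}`. [folklore] -/
theorem norm_pTerm (s : ℝ) (χ : ℂ) : ‖pTerm lam s χ‖ = Real.exp (-χ.re) := by
  rw [pTerm_apply, Complex.norm_exp]
  simp

/-- Off the closed unit disc (`Re χ > 0`) we have `|p| < 1`. [folklore] -/
theorem norm_pTerm_lt_one (s : ℝ) {χ : ℂ} (hχ : 0 < χ.re) : ‖pTerm lam s χ‖ < 1 := by
  rw [norm_pTerm, Real.exp_lt_one_iff]
  linarith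

/-- On the half-plane `Re χ ≥ ℓ` we have `|p| ≤ e^{-ℓ}`. [folklore] -/
theorem norm_pTerm_le (s : ℝ) {χ : ℂ} {ℓ : ℝ} (hχ : ℓ ≤ χ.re) : ‖pTerm lam s χ‖ ≤ Real.exp (-ℓ) := by
  rw [norm_pTerm, Real.exp_le_exp]
  linarith

/-- The **whole-plane Loewner field in logarithmic coordinates**:
`logField lam s χ = (p + 1)/(p - 1)`, `p = exp (-χ + i lam s)`, so that `u = exp χ` solves
`u̇ = V(s, u)` iff `χ̇ = logField (s, χ)` (Lawler (2005), (4.24) divided by `g_t`).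
[cite: Lawler2005, §4.3 eq. (4.24)] -/
def logField (s : ℝ) (χ : ℂ) : ℂ := (pTerm lam s χ + 1) / (pTerm lam s χ - 1)

/-- Unfolding lemma for `logField`. [folklore] -/
theorem logField_apply (s : ℝ) (χ : ℂ) :
    logField lam s χ = (pTerm lam s χ + 1) / (pTerm lam s χ - 1) := rfl

/-- For `|p| < 1` the denominator `p - 1` does not vanish. [folklore] -/
theorem pTerm_sub_one_ne_zero (s : ℝ) {χ : ℂ} (hχ : ‖pTerm lam s χ‖ < 1) : pTerm lam s χ - 1 ≠ 0 := by
  intro h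
  rw [sub_eq_zero] at h
  rw [h, norm_one] at hχ
  exact lt_irrefl _ hχ

/-- `logField = 1 + 2/(p - 1)`. [folklore] -/
theorem logField_eq (s : ℝ) {χ : ℂ} (hχ : ‖pTerm lam s χ‖ < 1) :
    logField lam s χ = 1 + 2 / (pTerm lam s χ - 1) := by
  have h := pTerm_sub_one_ne_zero lam s hχ
  rw [logField_apply]
  field_simp
  ring

/-- **The two coordinate systems agree**: `V(s, exp χ) = exp χ · logField (s, χ)`. [folklore] -/
theorem field_exp (s : ℝ) {χ : ℂ} (hχ : 0 < χ.re) :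
    field lam s (exp χ) = exp χ * logField lam s χ := by
  have hz : exp χ ≠ 0 := Complex.exp_ne_zero χ
  have hz1 : 1 < ‖exp χ‖ := by rw [Complex.norm_exp]; exact Real.one_lt_exp_iff.2 hχ
  have hden : drivW lam s - exp χ ≠ 0 := drivW_sub_ne_zero lam hz1
  have hp : pTerm lam s χ - 1 ≠ 0 := pTerm_sub_one_ne_zero lam s (norm_pTerm_lt_one lam s hχ)
  rw [pTerm_eq] at hp
  rw [logField_apply, pTerm_eq, field_eq]
  have hden' : (drivW lam s - exp χ) * (exp χ)⁻¹ = drivW lam s * (exp χ)⁻¹ - 1 := by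
    field_simp
  rw [← hden', div_mul_eq_div_div]
  field_simp

/-- **Sign of the real part**: `Re logField (s, χ) = -(1 - |p|²)/|1 - p|²`. [folklore] -/
theorem re_logField (s : ℝ) (χ : ℂ) :
    (logField lam s χ).re =
      -((1 - Complex.normSq (pTerm lam s χ)) / Complex.normSq (1 - pTerm lam s χ)) := by
  have h : logField lam s χ = -((1 + pTerm lam s χ) / (1 - pTerm lam s χ)) := by
    rw [logField_apply, ← neg_div_neg_eq, neg_sub]
    ring
  rw [h, Complex.neg_re, RadialLoewner.Disc.re_add_div_sub (by simp)]

/-- Bounds on `|1 - p|²`: `(1 - |p|)² ≤ |1 - p|² ≤ (1 + |p|)²`. [folklore] -/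
theorem normSq_one_sub_bounds (p : ℂ) :
    (1 - ‖p‖) ^ 2 ≤ Complex.normSq (1 - p) ∧ Complex.normSq (1 - p) ≤ (1 + ‖p‖) ^ 2 := by
  rw [Complex.normSq_eq_norm_sq]
  constructor
  · have h := abs_norm_sub_norm_le (1 : ℂ) p
    rw [norm_one] at h
    calc (1 - ‖p‖) ^ 2 = |1 - ‖p‖| ^ 2 := (sq_abs _).symm
      _ ≤ ‖1 - p‖ ^ 2 := pow_le_pow_left₀ (abs_nonneg _) h 2
  · have h := norm_sub_le (1 : ℂ) p
    rw [norm_one] at h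
    exact pow_le_pow_left₀ (norm_nonneg _) h 2

/-- `1 - |p| ≤ |p - 1|`. [folklore] -/
theorem one_sub_norm_le_norm_sub_one (p : ℂ) : 1 - ‖p‖ ≤ ‖p - 1‖ := by
  rw [norm_sub_rev]
  simpa using norm_sub_norm_le (1 : ℂ) p

/-- **The real part of the field is negative and quantitatively so**: for `|p| < 1`,
`-(1 + |p|)/(1 - |p|) ≤ Re logField ≤ -(1 - |p|)/(1 + |p|)`. [folklore] -/
theorem re_logField_bounds (s : ℝ) {χ : ℂ} (hχ : ‖pTerm lam s χ‖ < 1) :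
    -((1 + ‖pTerm lam s χ‖) / (1 - ‖pTerm lam s χ‖)) ≤ (logField lam s χ).re ∧
      (logField lam s χ).re ≤ -((1 - ‖pTerm lam s χ‖) / (1 + ‖pTerm lam s χ‖)) := by
  set p := pTerm lam s χ with hp
  have hr := norm_nonneg p
  obtain ⟨hlow, hup⟩ := normSq_one_sub_bounds p
  have hpos : 0 < Complex.normSq (1 - p) := lt_of_lt_of_le (by nlinarith) hlow
  have hnum : 1 - Complex.normSq p = (1 - ‖p‖) * (1 + ‖p‖) := by
    rw [Complex.normSq_eq_norm_sq]; ring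
  rw [re_logField, ← hp, neg_le_neg_iff, neg_le_neg_iff, hnum]
  constructor
  · -- `(1-|p|)(1+|p|)/|1-p|² ≤ (1+|p|)/(1-|p|)` since `|1-p|² ≥ (1-|p|)²`
    rw [div_le_div_iff₀ hpos (by linarith)]
    nlinarith [mul_le_mul_of_nonneg_left hlow (by linarith : (0 : ℝ) ≤ 1 + ‖p‖)]
  · -- `(1-|p|)/(1+|p|) ≤ (1-|p|)(1+|p|)/|1-p|²` since `|1-p|² ≤ (1+|p|)²`
    rw [div_le_div_iff₀ (by linarith) hpos]
    nlinarith [mul_le_mul_of_nonneg_left hup (by linarith : (0 : ℝ) ≤ 1 - ‖p‖)]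

/-- The real part of the field is negative off the closed unit disc. [folklore] -/
theorem re_logField_neg (s : ℝ) {χ : ℂ} (hχ : ‖pTerm lam s χ‖ < 1) : (logField lam s χ).re < 0 := by
  refine lt_of_le_of_lt (re_logField_bounds lam s hχ).2 (neg_neg_of_pos (div_pos ?_ ?_)) <;>
    linarith [norm_nonneg (pTerm lam s χ)]

/-- **Bound on the field**: `|logField| ≤ (1 + |p|)/(1 - |p|)`. [folklore] -/
theorem norm_logField_le (s : ℝ) {χ : ℂ} (hχ : ‖pTerm lam s χ‖ < 1) :
    ‖logField lam s χ‖ ≤ (1 + ‖pTerm lam s χ‖) / (1 - ‖pTerm lam s χ‖) := by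
  rw [logField_apply, norm_div]
  have hden : 1 - ‖pTerm lam s χ‖ ≤ ‖pTerm lam s χ - 1‖ := one_sub_norm_le_norm_sub_one _
  have hnum : ‖pTerm lam s χ + 1‖ ≤ 1 + ‖pTerm lam s χ‖ := by
    rw [add_comm]; exact (norm_add_le _ _).trans (by rw [norm_one])
  exact div_le_div₀ (by linarith [norm_nonneg (pTerm lam s χ)]) hnum (by linarith) hden

/-- **The additive part of the field**: `logField + 1 = 2p/(p - 1)`, of norm `≤ 2|p|/(1 - |p|)`
(this is `d/ds (χ + s)`, small when `|u|` is large). [folklore] -/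
theorem norm_logField_add_one_le (s : ℝ) {χ : ℂ} (hχ : ‖pTerm lam s χ‖ < 1) :
    ‖logField lam s χ + 1‖ ≤ 2 * ‖pTerm lam s χ‖ / (1 - ‖pTerm lam s χ‖) := by
  have h := pTerm_sub_one_ne_zero lam s hχ
  have heq : logField lam s χ + 1 = 2 * pTerm lam s χ / (pTerm lam s χ - 1) := by
    rw [logField_apply]; field_simp; ring
  rw [heq, norm_div, norm_mul, Complex.norm_two]
  have hden : 1 - ‖pTerm lam s χ‖ ≤ ‖pTerm lam s χ - 1‖ := one_sub_norm_le_norm_sub_one _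
  exact div_le_div_of_nonneg_left (by positivity) (by linarith) hden

/-- `p` is `e^{-ℓ}`-Lipschitz in `χ` on the half-plane `{Re χ ≥ ℓ}`. [folklore] -/
theorem norm_pTerm_sub_pTerm_le (s : ℝ) {ℓ : ℝ} {χ₁ χ₂ : ℂ} (h₁ : ℓ ≤ χ₁.re) (h₂ : ℓ ≤ χ₂.re) :
    ‖pTerm lam s χ₁ - pTerm lam s χ₂‖ ≤ Real.exp (-ℓ) * ‖χ₁ - χ₂‖ := by
  have hderiv : ∀ x ∈ {x : ℂ | ℓ ≤ x.re}, HasDerivWithinAt (pTerm lam s)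
      (-pTerm lam s x) {x : ℂ | ℓ ≤ x.re} x := by
    intro x _
    have h1 : HasDerivAt (fun x : ℂ ↦ -x + lam s * I) (-1) x := by
      simpa using (hasDerivAt_neg x).add_const (lam s * I)
    have h2 := h1.cexp
    simp only [mul_neg, mul_one] at h2
    exact h2.hasDerivWithinAt
  have hbound : ∀ x ∈ {x : ℂ | ℓ ≤ x.re}, ‖-pTerm lam s x‖ ≤ Real.exp (-ℓ) := fun x hx ↦ by
    rw [norm_neg]; exact norm_pTerm_le lam s hx
  have := (convex_halfSpace_re_ge ℓ).norm_image_sub_le_of_norm_hasDerivWithin_le hderiv hbound h₂ h₁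
  simpa using this

/-- **Lipschitz estimate in logarithmic coordinates**: on `{Re χ ≥ ℓ}`, `ℓ > 0`,
`|logField (s, χ₁) - logField (s, χ₂)| ≤ 2 e^{-ℓ}/(1 - e^{-ℓ})² · |χ₁ - χ₂|`. [folklore] -/
theorem norm_logField_sub_le (s : ℝ) {ℓ : ℝ} (hℓ : 0 < ℓ) {χ₁ χ₂ : ℂ} (h₁ : ℓ ≤ χ₁.re)
    (h₂ : ℓ ≤ χ₂.re) :
    ‖logField lam s χ₁ - logField lam s χ₂‖ ≤
      2 * Real.exp (-ℓ) / (1 - Real.exp (-ℓ)) ^ 2 * ‖χ₁ - χ₂‖ := by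
  have hr : Real.exp (-ℓ) < 1 := Real.exp_lt_one_iff.2 (by linarith)
  have hp₁ := norm_pTerm_le lam s h₁
  have hp₂ := norm_pTerm_le lam s h₂
  have hq₁ : pTerm lam s χ₁ - 1 ≠ 0 := pTerm_sub_one_ne_zero lam s (hp₁.trans_lt hr)
  have hq₂ : pTerm lam s χ₂ - 1 ≠ 0 := pTerm_sub_one_ne_zero lam s (hp₂.trans_lt hr)
  rw [logField_eq lam s (hp₁.trans_lt hr), logField_eq lam s (hp₂.trans_lt hr)]
  have heq : (1 + 2 / (pTerm lam s χ₁ - 1)) - (1 + 2 / (pTerm lam s χ₂ - 1)) =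
      2 * (pTerm lam s χ₂ - pTerm lam s χ₁) / ((pTerm lam s χ₁ - 1) * (pTerm lam s χ₂ - 1)) := by
    field_simp; ring
  rw [heq, norm_div, norm_mul, norm_mul, Complex.norm_two]
  have hd₁ : 1 - Real.exp (-ℓ) ≤ ‖pTerm lam s χ₁ - 1‖ :=
    le_trans (by linarith) (one_sub_norm_le_norm_sub_one _)
  have hd₂ : 1 - Real.exp (-ℓ) ≤ ‖pTerm lam s χ₂ - 1‖ :=
    le_trans (by linarith) (one_sub_norm_le_norm_sub_one _)
  have hnum := norm_pTerm_sub_pTerm_le lam s h₂ h₁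
  rw [norm_sub_rev χ₂ χ₁] at hnum
  have hdpos : 0 < 1 - Real.exp (-ℓ) := by linarith
  calc 2 * ‖pTerm lam s χ₂ - pTerm lam s χ₁‖ / (‖pTerm lam s χ₁ - 1‖ * ‖pTerm lam s χ₂ - 1‖)
      ≤ 2 * (Real.exp (-ℓ) * ‖χ₁ - χ₂‖) / ((1 - Real.exp (-ℓ)) * (1 - Real.exp (-ℓ))) := by
        refine div_le_div₀ (by positivity) (by linarith) (by positivity) ?_
        exact mul_le_mul hd₁ hd₂ hdpos.le (norm_nonneg _)
    _ = 2 * Real.exp (-ℓ) / (1 - Real.exp (-ℓ)) ^ 2 * ‖χ₁ - χ₂‖ := by ring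

/-! ### Truncation of the real part and the truncated field -/

/-- Lift the real part to at least `ℓ`: `liftRe ℓ x = max (re x) ℓ + i im x` (the analogue of
`Loewner.liftIm`). [folklore] -/
def liftRe (ℓ : ℝ) (x : ℂ) : ℂ := ⟨max x.re ℓ, x.im⟩

/-- Real part of `liftRe`. [folklore] -/
@[simp] theorem liftRe_re (ℓ : ℝ) (x : ℂ) : (liftRe ℓ x).re = max x.re ℓ := rfl

/-- Imaginary part of `liftRe`. [folklore] -/
@[simp] theorem liftRe_im (ℓ : ℝ) (x : ℂ) : (liftRe ℓ x).im = x.im := rfl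

/-- `liftRe ℓ` fixes the points with `re x ≥ ℓ`. [folklore] -/
theorem liftRe_of_le {ℓ : ℝ} {x : ℂ} (h : ℓ ≤ x.re) : liftRe ℓ x = x :=
  Complex.ext (max_eq_left h) rfl

/-- `ℓ ≤ re (liftRe ℓ x)`. [folklore] -/
theorem le_re_liftRe (ℓ : ℝ) (x : ℂ) : ℓ ≤ (liftRe ℓ x).re := le_max_right _ _

/-- `liftRe ℓ` is `1`-Lipschitz. [folklore] -/
theorem lipschitzWith_liftRe (ℓ : ℝ) : LipschitzWith 1 (liftRe ℓ) := by
  refine LipschitzWith.of_dist_le_mul fun x y ↦ ?_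
  rw [NNReal.coe_one, one_mul, Complex.dist_eq, Complex.dist_eq]
  have him : (liftRe ℓ x - liftRe ℓ y).im = (x - y).im := by simp
  have hre : |(liftRe ℓ x - liftRe ℓ y).re| ≤ |(x - y).re| := by
    simpa using abs_max_sub_max_le_abs x.re y.re ℓ
  rw [Complex.norm_def, Complex.norm_def, Real.sqrt_le_sqrt_iff (Complex.normSq_nonneg _),
    Complex.normSq_apply, Complex.normSq_apply, him]
  nlinarith [sq_abs (liftRe ℓ x - liftRe ℓ y).re, sq_abs (x - y).re, abs_nonneg (x - y).re,
    abs_nonneg (liftRe ℓ x - liftRe ℓ y).re]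

/-- `liftRe ℓ` is continuous. [folklore] -/
theorem continuous_liftRe (ℓ : ℝ) : Continuous (liftRe ℓ) := (lipschitzWith_liftRe ℓ).continuous

/-- The **truncated field** `truncField lam ℓ s χ = logField lam s (liftRe ℓ χ)`: globally bounded
and Lipschitz for `ℓ > 0`, and equal to `logField` where `Re χ ≥ ℓ` (which is where the
trajectories through points with `log |w| > ℓ` live for `s ≤ t`). [folklore] -/
def truncField (ℓ : ℝ) (s : ℝ) (χ : ℂ) : ℂ := logField lam s (liftRe ℓ χ)

/-- Unfolding lemma for `truncField`. [folklore] -/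
theorem truncField_apply (ℓ s : ℝ) (χ : ℂ) : truncField lam ℓ s χ = logField lam s (liftRe ℓ χ) := rfl

/-- Where `Re χ ≥ ℓ` the truncation is inactive. [folklore] -/
theorem truncField_of_le {ℓ : ℝ} (s : ℝ) {χ : ℂ} (h : ℓ ≤ χ.re) :
    truncField lam ℓ s χ = logField lam s χ := by
  rw [truncField_apply, liftRe_of_le h]

/-- `|p (liftRe ℓ χ)| ≤ e^{-ℓ}`. [folklore] -/
theorem norm_pTerm_liftRe_le (ℓ s : ℝ) (χ : ℂ) : ‖pTerm lam s (liftRe ℓ χ)‖ ≤ Real.exp (-ℓ) :=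
  norm_pTerm_le lam s (le_re_liftRe ℓ χ)

section Trunc

variable {ℓ : ℝ} (hℓ : 0 < ℓ)
include hℓ

/-- `e^{-ℓ} < 1` for `ℓ > 0`. [folklore] -/
theorem exp_neg_lt_one : Real.exp (-ℓ) < 1 := Real.exp_lt_one_iff.2 (by linarith)

/-- **The truncated field is bounded** by `2/(1 - e^{-ℓ})`. [folklore] -/
theorem norm_truncField_le (s : ℝ) (χ : ℂ) : ‖truncField lam ℓ s χ‖ ≤ 2 / (1 - Real.exp (-ℓ)) := by
  have hr := exp_neg_lt_one hℓ
  have hp := norm_pTerm_liftRe_le lam ℓ s χ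
  rw [truncField_apply]
  refine (norm_logField_le lam s (hp.trans_lt hr)).trans ?_
  have h0 := norm_nonneg (pTerm lam s (liftRe ℓ χ))
  exact div_le_div₀ (by norm_num) (by linarith) (by linarith) (by linarith)

/-- **The truncated field is globally Lipschitz** with constant `2 e^{-ℓ}/(1 - e^{-ℓ})²`. [folklore] -/
theorem lipschitzWith_truncField (s : ℝ) :
    LipschitzWith (2 * Real.exp (-ℓ) / (1 - Real.exp (-ℓ)) ^ 2).toNNReal (truncField lam ℓ s) := by
  refine LipschitzWith.of_dist_le_mul fun x y ↦ ?_
  rw [Real.coe_toNNReal _ (by positivity), dist_eq_norm, dist_eq_norm, truncField_apply,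
    truncField_apply]
  refine (norm_logField_sub_le lam s hℓ (le_re_liftRe ℓ x) (le_re_liftRe ℓ y)).trans ?_
  gcongr
  rw [← dist_eq_norm, ← dist_eq_norm]
  simpa using (lipschitzWith_liftRe ℓ).dist_le_mul x y

/-- The truncated field is continuous in time (continuous driving angle). [folklore] -/
theorem continuous_truncField {lam : ℝ → ℝ} (hlam : Continuous lam) (χ : ℂ) :
    Continuous fun s ↦ truncField lam ℓ s χ := by
  have hr := exp_neg_lt_one hℓ
  have hden : ∀ s, pTerm lam s (liftRe ℓ χ) - 1 ≠ 0 := fun s ↦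
    pTerm_sub_one_ne_zero lam s ((norm_pTerm_liftRe_le lam ℓ s χ).trans_lt hr)
  simp only [truncField_apply, logField_apply, pTerm_apply]
  refine Continuous.div ?_ ?_ (by simpa [pTerm_apply] using hden) <;> fun_prop

/-- The real part of the truncated field is non-positive. [folklore] -/
theorem re_truncField_nonpos (s : ℝ) (χ : ℂ) : (truncField lam ℓ s χ).re ≤ 0 :=
  (re_logField_neg lam s ((norm_pTerm_liftRe_le lam ℓ s χ).trans_lt (exp_neg_lt_one hℓ))).le

/-- **Picard–Lindelöf for the truncated field** on the window `[t - T, t + 1]`, initial time `t`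
(one cylinder: the field is globally bounded and Lipschitz). [folklore] -/
theorem isPicardLindelof_truncField {lam : ℝ → ℝ} (hlam : Continuous lam) (t : ℝ) {T : ℝ}
    (hT : 0 ≤ T) (χ₀ : ℂ) :
    IsPicardLindelof (truncField lam ℓ)
      (⟨t, by constructor <;> linarith⟩ : Icc (t - T) (t + 1)) χ₀
      ((2 / (1 - Real.exp (-ℓ))).toNNReal * (T + 1).toNNReal) 0 (2 / (1 - Real.exp (-ℓ))).toNNReal
      (2 * Real.exp (-ℓ) / (1 - Real.exp (-ℓ)) ^ 2).toNNReal where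
  lipschitzOnWith s _ := (lipschitzWith_truncField lam hℓ s).lipschitzOnWith
  continuousOn x _ := (continuous_truncField hℓ hlam x).continuousOn
  norm_le s _ x _ := by
    rw [Real.coe_toNNReal _ (by have := exp_neg_lt_one hℓ; positivity)]
    exact norm_truncField_le lam hℓ s x
  mul_max_le := by
    have hr := exp_neg_lt_one hℓ
    rw [NNReal.coe_mul, Real.coe_toNNReal _ (by positivity), Real.coe_toNNReal _ (by positivity),
      NNReal.coe_zero, sub_zero]
    gcongr
    exact max_le (by linarith) (by linarith)

/-- **Solutions of the truncated equation on every window** `[t - T, t + 1]` with `χ(t) = χ₀`.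
[folklore] -/
theorem exists_truncSol {lam : ℝ → ℝ} (hlam : Continuous lam) (t : ℝ) {T : ℝ} (hT : 0 ≤ T)
    (χ₀ : ℂ) : ∃ χ : ℝ → ℂ, χ t = χ₀ ∧ ∀ s ∈ Icc (t - T) (t + 1),
      HasDerivWithinAt χ (truncField lam ℓ s (χ s)) (Icc (t - T) (t + 1)) s :=
  (isPicardLindelof_truncField hℓ hlam t hT χ₀).exists_eq_forall_mem_Icc_hasDerivWithinAt₀

/-- **Uniqueness for the truncated equation** on a window: two solutions on `[a, b]`
(`a ≤ t ≤ b`) with the same value at `t` agree on `[a, b]`. [folklore] -/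
theorem truncSol_unique {χ₁ χ₂ : ℝ → ℂ} {a b t : ℝ} (hat : a ≤ t) (htb : t ≤ b)
    (h₁ : ∀ s ∈ Icc a b, HasDerivWithinAt χ₁ (truncField lam ℓ s (χ₁ s)) (Icc a b) s)
    (h₂ : ∀ s ∈ Icc a b, HasDerivWithinAt χ₂ (truncField lam ℓ s (χ₂ s)) (Icc a b) s)
    (heq : χ₁ t = χ₂ t) : EqOn χ₁ χ₂ (Icc a b) := by
  have hK : ∀ s, LipschitzOnWith (2 * Real.exp (-ℓ) / (1 - Real.exp (-ℓ)) ^ 2).toNNReal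
      (truncField lam ℓ s) univ := fun s ↦ (lipschitzWith_truncField lam hℓ s).lipschitzOnWith
  have hc₁ : ContinuousOn χ₁ (Icc a b) := fun s hs ↦ (h₁ s hs).continuousWithinAt
  have hc₂ : ContinuousOn χ₂ (Icc a b) := fun s hs ↦ (h₂ s hs).continuousWithinAt
  -- on `[t, b]`
  have hright : EqOn χ₁ χ₂ (Icc t b) := by
    refine ODE_solution_unique_of_mem_Icc_right (v := truncField lam ℓ) (s := fun _ ↦ univ)
      (fun s _ ↦ hK s) (hc₁.mono (Icc_subset_Icc_left hat)) (fun s hs ↦ ?_) (fun _ _ ↦ trivial)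
      (hc₂.mono (Icc_subset_Icc_left hat)) (fun s hs ↦ ?_) (fun _ _ ↦ trivial) heq
    · exact (h₁ s ⟨hat.trans hs.1, hs.2.le⟩).mono_of_mem_nhdsWithin
        (mem_of_superset (Icc_mem_nhdsGE hs.2) (Icc_subset_Icc_left (hat.trans hs.1)))
    · exact (h₂ s ⟨hat.trans hs.1, hs.2.le⟩).mono_of_mem_nhdsWithin
        (mem_of_superset (Icc_mem_nhdsGE hs.2) (Icc_subset_Icc_left (hat.trans hs.1)))
  -- on `[a, t]`
  have hleft : EqOn χ₁ χ₂ (Icc a t) := by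
    refine ODE_solution_unique_of_mem_Icc_left (v := truncField lam ℓ) (s := fun _ ↦ univ)
      (fun s _ ↦ hK s) (hc₁.mono (Icc_subset_Icc_right htb)) (fun s hs ↦ ?_) (fun _ _ ↦ trivial)
      (hc₂.mono (Icc_subset_Icc_right htb)) (fun s hs ↦ ?_) (fun _ _ ↦ trivial) heq
    · exact (h₁ s ⟨hs.1.le, hs.2.trans htb⟩).mono_of_mem_nhdsWithin
        (mem_of_superset (Icc_mem_nhdsLE hs.1) (Icc_subset_Icc_right (hs.2.trans htb)))
    · exact (h₂ s ⟨hs.1.le, hs.2.trans htb⟩).mono_of_mem_nhdsWithin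
        (mem_of_superset (Icc_mem_nhdsLE hs.1) (Icc_subset_Icc_right (hs.2.trans htb)))
  intro s hs
  rcases le_total s t with hst | hst
  · exact hleft ⟨hs.1, hst⟩
  · exact hright ⟨hst, hs.2⟩

/-- Along a solution of the truncated equation the real part decreases. [folklore] -/
theorem truncSol_re_antitoneOn {χ : ℝ → ℂ} {a b : ℝ}
    (hd : ∀ s ∈ Icc a b, HasDerivWithinAt χ (truncField lam ℓ s (χ s)) (Icc a b) s) :
    AntitoneOn (fun s ↦ (χ s).re) (Icc a b) := by
  have hy : ∀ s ∈ Icc a b, HasDerivWithinAt (fun s ↦ (χ s).re)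
      (truncField lam ℓ s (χ s)).re (Icc a b) s := fun s hs ↦
    Complex.reCLM.hasFDerivAt.comp_hasDerivWithinAt s (hd s hs)
  exact antitoneOn_of_hasDerivWithinAt_nonpos (convex_Icc _ _)
    (fun s hs ↦ (hy s hs).continuousWithinAt)
    (fun s hs' ↦ (hy s (interior_subset hs')).mono interior_subset) fun s _ ↦
    re_truncField_nonpos lam hℓ s (χ s)

/-- **The truncated equation has a solution on `(-∞, t + 1]`** with `χ(t) = χ₀`: patch the
solutions on the windows `[t - n, t + 1]`, `n ∈ ℕ`, which agree by uniqueness. [folklore] -/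
theorem exists_globalTruncSol {lam : ℝ → ℝ} (hlam : Continuous lam) (t : ℝ) (χ₀ : ℂ) :
    ∃ χ : ℝ → ℂ, χ t = χ₀ ∧ ContinuousOn χ (Iic (t + 1)) ∧
      (∀ s < t + 1, HasDerivAt χ (truncField lam ℓ s (χ s)) s) ∧
      AntitoneOn (fun s ↦ (χ s).re) (Iic (t + 1)) := by
  have hex : ∀ n : ℕ, ∃ χ : ℝ → ℂ, χ t = χ₀ ∧ ∀ s ∈ Icc (t - n) (t + 1),
      HasDerivWithinAt χ (truncField lam ℓ s (χ s)) (Icc (t - n) (t + 1)) s :=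
    fun n ↦ exists_truncSol hℓ hlam t n.cast_nonneg χ₀
  choose X hX0 hXd using hex
  -- the windows agree
  have hagree : ∀ n m : ℕ, n ≤ m → EqOn (X n) (X m) (Icc (t - n) (t + 1)) := by
    intro n m hnm
    have hsub : Icc (t - n) (t + 1) ⊆ Icc (t - m) (t + 1) :=
      Icc_subset_Icc_left (by have : (n : ℝ) ≤ m := Nat.cast_le.2 hnm; linarith)
    refine truncSol_unique lam hℓ (a := t - n) (b := t + 1) (t := t) (by simp) (by linarith)
      (hXd n) (fun s hs ↦ (hXd m s (hsub hs)).mono hsub) ?_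
    rw [hX0 n, hX0 m]
  -- the patched function
  set N : ℝ → ℕ := fun s ↦ ⌈t - s⌉₊ with hN
  set χ : ℝ → ℂ := fun s ↦ X (N s) s with hχ
  have hmemN : ∀ s ≤ t + 1, s ∈ Icc (t - N s) (t + 1) := fun s hs ↦
    ⟨by have := Nat.le_ceil (t - s); simp only [hN]; linarith, hs⟩
  -- locally, `χ` is one of the `X n`
  have hloc : ∀ s₀ < t + 1, ∃ n : ℕ, t - n < s₀ ∧ ∀ s ∈ Ioo (s₀ - 1) (t + 1), χ s = X n s := by
    intro s₀ hs₀
    refine ⟨N s₀ + 1, ?_, fun s hs ↦ ?_⟩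
    · have := Nat.le_ceil (t - s₀)
      simp only [hN]; push_cast; linarith
    · have hNs : N s ≤ N s₀ + 1 := by
        simp only [hN]
        refine Nat.ceil_le.2 ?_
        have := Nat.le_ceil (t - s₀)
        push_cast
        linarith [hs.1]
      exact hagree (N s) (N s₀ + 1) hNs (hmemN s hs.2.le)
  refine ⟨χ, ?_, ?_, ?_, ?_⟩
  · simp only [hχ]; exact hX0 _
  · intro s₀ hs₀
    rcases lt_or_eq_of_le (mem_Iic.1 hs₀) with hlt | heq
    · obtain ⟨n, hn, hloc'⟩ := hloc s₀ hlt
      have hcont : ContinuousAt (X n) s₀ :=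
        ((hXd n s₀ ⟨hn.le, hlt.le⟩).hasDerivAt (Icc_mem_nhds hn hlt)).continuousAt
      have hev : χ =ᶠ[𝓝 s₀] X n := by
        filter_upwards [Ioo_mem_nhds (by linarith : s₀ - 1 < s₀) hlt] with s hs using hloc' s hs
      exact (hcont.congr hev.symm).continuousWithinAt
    · -- at the right end `t + 1`: `χ = X 0` on `(t, t + 1]`
      subst heq
      have hcont : ContinuousWithinAt (X 0) (Icc (t - (0 : ℕ)) (t + 1)) (t + 1) :=
        (hXd 0 (t + 1) ⟨by simp, le_rfl⟩).continuousWithinAt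
      have hev : χ =ᶠ[𝓝[Iic (t + 1)] (t + 1)] X 0 := by
        have : Ioc t (t + 1) ∈ 𝓝[Iic (t + 1)] (t + 1) := Ioc_mem_nhdsLE (by linarith)
        filter_upwards [this] with s hs
        have hNs : N s = 0 := by simp only [hN]; exact Nat.ceil_eq_zero.2 (by linarith [hs.1])
        simp only [hχ, hNs]
      have hval : χ (t + 1) = X 0 (t + 1) := by
        have hNs : N (t + 1) = 0 := by simp only [hN]; exact Nat.ceil_eq_zero.2 (by linarith)
        simp only [hχ, hNs]
      have hmono : ContinuousWithinAt (X 0) (Iic (t + 1)) (t + 1) := by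
        refine hcont.mono_of_mem_nhdsWithin ?_
        simp only [Nat.cast_zero, sub_zero]
        exact Icc_mem_nhdsLE (by linarith)
      exact (hmono.congr_of_eventuallyEq hev hval)
  · intro s₀ hs₀
    obtain ⟨n, hn, hloc'⟩ := hloc s₀ hs₀
    have hder : HasDerivAt (X n) (truncField lam ℓ s₀ (X n s₀)) s₀ :=
      (hXd n s₀ ⟨hn.le, hs₀.le⟩).hasDerivAt (Icc_mem_nhds hn hs₀)
    have hev : χ =ᶠ[𝓝 s₀] X n := by
      filter_upwards [Ioo_mem_nhds (by linarith : s₀ - 1 < s₀) hs₀] with s hs using hloc' s hs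
    have hval : χ s₀ = X n s₀ := hloc' s₀ ⟨by linarith, hs₀⟩
    rw [hval]
    exact hder.congr_of_eventuallyEq hev
  · -- antitone real part: compare inside one window
    intro a ha b hb hab
    have hb' : b ≤ t + 1 := hb
    have ha' : a ≤ t + 1 := ha
    set n : ℕ := N a with hn
    have hamem : a ∈ Icc (t - n) (t + 1) := hmemN a ha'
    have hbmem : b ∈ Icc (t - n) (t + 1) := ⟨hamem.1.trans hab, hb'⟩
    have hmono := truncSol_re_antitoneOn lam hℓ (hXd n) hamem hbmem hab
    have hNb : N b ≤ n := by simp only [hn, hN]; exact Nat.ceil_mono (by linarith)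
    have hbeq : χ b = X n b := hagree (N b) n hNb (hmemN b hb')
    have haeq : χ a = X n a := rfl
    simp only [haeq, hbeq]
    exact hmono

end Trunc

/-! ### The trajectory through `(t, w)` -/

/-- The truncation level used for the trajectory through `w`: half of `log |w|`. [folklore] -/
def level (w : ℂ) : ℝ := Real.log ‖w‖ / 2

/-- For `|w| > 1` the level is positive. [folklore] -/
theorem level_pos {w : ℂ} (hw : 1 < ‖w‖) : 0 < level w := by
  unfold level; have := Real.log_pos hw; linarith

/-- For `|w| > 1` the level is below `log |w| = Re (log w)`. [folklore] -/
theorem level_lt_log {w : ℂ} (hw : 1 < ‖w‖) : level w < Real.log ‖w‖ := by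
  unfold level; have := Real.log_pos hw; linarith

/-- The defining property of the **logarithmic trajectory through `(t, w)`**: a solution of the
truncated equation at level `level w` on `(-∞, t + 1)` with `χ(t) = log w`, continuous on
`(-∞, t + 1]`, with decreasing real part. [folklore] -/
structure IsLogOrbit (t : ℝ) (w : ℂ) (χ : ℝ → ℂ) : Prop where
  /-- initial value -/
  apply_self : χ t = Complex.log w
  /-- continuity up to `t + 1` -/
  continuousOn : ContinuousOn χ (Iic (t + 1))
  /-- the truncated equation before `t + 1` -/
  hasDerivAt : ∀ s < t + 1, HasDerivAt χ (truncField lam (level w) s (χ s)) s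
  /-- the real part decreases -/
  antitoneOn : AntitoneOn (fun s ↦ (χ s).re) (Iic (t + 1))

/-- The **logarithmic trajectory through `(t, w)`** (by choice; junk `log w` if none exists, which
does not happen for continuous `lam`). [folklore] -/
def logOrbit (t : ℝ) (w : ℂ) : ℝ → ℂ := by
  classical
  exact if h : ∃ χ, IsLogOrbit lam t w χ then h.choose else fun _ ↦ Complex.log w

/-- **The whole-plane Loewner trajectory through `(t, w)`**: `orbit lam t w s = u(s)` where
`u̇ = V(s, u)`, `u(t) = w`; meaningful for `|w| > 1`, `s ≤ t` (and slightly beyond `t`). This is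
the backward flow `F_{s,t}` of Lawler (2005), §4.3 followed pointwise. [cite: Lawler2005, §4.3 Prop. 4.21] -/
def orbit (t : ℝ) (w : ℂ) (s : ℝ) : ℂ := exp (logOrbit lam t w s)

variable {lam}

section Orbit

variable (hlam : Continuous lam) {t : ℝ} {w : ℂ} (hw : 1 < ‖w‖)
include hlam hw

/-- For a continuous driving angle the logarithmic trajectory has its defining property.
[folklore] -/
theorem isLogOrbit_logOrbit : IsLogOrbit lam t w (logOrbit lam t w) := by
  classical
  have hex : ∃ χ, IsLogOrbit lam t w χ := by
    obtain ⟨χ, h0, hc, hd, hm⟩ := exists_globalTruncSol (level_pos hw) hlam t (Complex.log w)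
    exact ⟨χ, ⟨h0, hc, hd, hm⟩⟩
  rw [logOrbit, dif_pos hex]
  exact hex.choose_spec

/-- `logOrbit t w t = log w`. [folklore] -/
theorem logOrbit_self : logOrbit lam t w t = Complex.log w := (isLogOrbit_logOrbit hlam hw).apply_self

/-- **The real part only grows backward**: `log |w| ≤ Re logOrbit (s)` for `s ≤ t`. [folklore] -/
theorem log_norm_le_re_logOrbit {s : ℝ} (hs : s ≤ t) : Real.log ‖w‖ ≤ (logOrbit lam t w s).re := by
  have h := (isLogOrbit_logOrbit hlam hw).antitoneOn (show s ∈ Iic (t + 1) from by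
    simp only [mem_Iic]; linarith) (show t ∈ Iic (t + 1) from by simp) hs
  simpa [logOrbit_self hlam hw, Complex.log_re] using h

/-- Before time `t` the trajectory stays strictly above the truncation level. [folklore] -/
theorem level_lt_re_logOrbit {s : ℝ} (hs : s ≤ t) : level w < (logOrbit lam t w s).re :=
  (level_lt_log hw).trans_le (log_norm_le_re_logOrbit hlam hw hs)

/-- **The logarithmic trajectory solves the true equation** `χ̇ = logField (s, χ)` at every
`s ≤ t` (the truncation is inactive there). [folklore] -/
theorem hasDerivAt_logOrbit {s : ℝ} (hs : s ≤ t) :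
    HasDerivAt (logOrbit lam t w) (logField lam s (logOrbit lam t w s)) s := by
  have h := (isLogOrbit_logOrbit hlam hw).hasDerivAt s (by linarith)
  rwa [truncField_of_le lam s (level_lt_re_logOrbit hlam hw hs).le] at h

/-- More generally the true equation holds wherever `s < t + 1` and `Re χ(s) > level w`.
[folklore] -/
theorem hasDerivAt_logOrbit_of_lt {s : ℝ} (hs : s < t + 1) (hre : level w < (logOrbit lam t w s).re) :
    HasDerivAt (logOrbit lam t w) (logField lam s (logOrbit lam t w s)) s := by
  have h := (isLogOrbit_logOrbit hlam hw).hasDerivAt s hs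
  rwa [truncField_of_le lam s hre.le] at h

/-- The logarithmic trajectory is continuous on `(-∞, t + 1]`. [folklore] -/
theorem continuousOn_logOrbit : ContinuousOn (logOrbit lam t w) (Iic (t + 1)) :=
  (isLogOrbit_logOrbit hlam hw).continuousOn

/-- `orbit t w t = w`. [folklore] -/
theorem orbit_self : orbit lam t w t = w := by
  rw [orbit, logOrbit_self hlam hw, Complex.exp_log]
  exact norm_pos_iff.1 (by linarith)

omit hlam hw in
/-- `|orbit s| = exp (Re logOrbit s)`. [folklore] -/
theorem norm_orbit (s : ℝ) : ‖orbit lam t w s‖ = Real.exp (logOrbit lam t w s).re := by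
  rw [orbit, Complex.norm_exp]

/-- **`|w| ≤ |orbit s|` for `s ≤ t`**: backward, points move away from the disc. [folklore] -/
theorem norm_le_norm_orbit {s : ℝ} (hs : s ≤ t) : ‖w‖ ≤ ‖orbit lam t w s‖ := by
  rw [norm_orbit]
  have h := Real.exp_le_exp.2 (log_norm_le_re_logOrbit hlam hw hs)
  rwa [Real.exp_log (by linarith)] at h

/-- The trajectory stays outside the closed unit disc for `s ≤ t`. [folklore] -/
theorem one_lt_norm_orbit {s : ℝ} (hs : s ≤ t) : 1 < ‖orbit lam t w s‖ :=
  hw.trans_le (norm_le_norm_orbit hlam hw hs)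

/-- **The trajectory solves the whole-plane Loewner equation** `u̇ = V(s, u)` at every `s ≤ t`.
[cite: Lawler2005, §4.3 eq. (4.24)] -/
theorem hasDerivAt_orbit {s : ℝ} (hs : s ≤ t) :
    HasDerivAt (orbit lam t w) (field lam s (orbit lam t w s)) s := by
  have hre : 0 < (logOrbit lam t w s).re := (level_pos hw).trans (level_lt_re_logOrbit hlam hw hs)
  have h := (hasDerivAt_logOrbit hlam hw hs).cexp
  rw [← field_exp lam s hre] at h
  exact h

/-- The trajectory is continuous on `(-∞, t + 1]`. [folklore] -/
theorem continuousOn_orbit : ContinuousOn (orbit lam t w) (Iic (t + 1)) :=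
  Complex.continuous_exp.comp_continuousOn (continuousOn_logOrbit hlam hw)

/-- The **norm of the trajectory is antitone in time** on `(-∞, t + 1]`. [folklore] -/
theorem norm_orbit_antitoneOn : AntitoneOn (fun s ↦ ‖orbit lam t w s‖) (Iic (t + 1)) := by
  intro a ha b hb hab
  simp only [norm_orbit]
  exact Real.exp_le_exp.2 ((isLogOrbit_logOrbit hlam hw).antitoneOn ha hb hab)

/-- **Forward extension.** The trajectory solves the true equation, and stays outside the closed
unit disc, on a whole neighbourhood `(-∞, t + ε]`, `ε > 0`, of `(-∞, t]`. [folklore] -/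
theorem exists_forward : ∃ ε > 0, ε ≤ 1 ∧ ∀ s ≤ t + ε,
    HasDerivAt (orbit lam t w) (field lam s (orbit lam t w s)) s ∧ 1 < ‖orbit lam t w s‖ := by
  -- `Re χ > level w` persists a little after `t` by continuity within `(-∞, t + 1]`
  have hcont : ContinuousWithinAt (fun s ↦ (logOrbit lam t w s).re) (Iic (t + 1)) t :=
    Complex.continuous_re.continuousAt.comp_continuousWithinAt
      (continuousOn_logOrbit hlam hw t (by simp))
  have hgt : level w < (logOrbit lam t w t).re := level_lt_re_logOrbit hlam hw le_rfl
  have hev : ∀ᶠ s in 𝓝[Iic (t + 1)] t, level w < (logOrbit lam t w s).re :=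
    hcont.eventually (lt_mem_nhds hgt)
  have hev' : ∀ᶠ s in 𝓝 t, s ∈ Iic (t + 1) → level w < (logOrbit lam t w s).re :=
    eventually_nhdsWithin_iff.1 hev
  obtain ⟨δ, hδ, hball⟩ := Metric.eventually_nhds_iff.1 hev'
  refine ⟨min (δ / 2) (1 / 2), by positivity, (min_le_right _ _).trans (by norm_num), fun s hs ↦ ?_⟩
  have hs1 : s < t + 1 := by
    have := min_le_right (δ / 2) (1 / 2); linarith
  have hre : level w < (logOrbit lam t w s).re := by
    rcases le_or_gt s t with hst | hst
    · exact level_lt_re_logOrbit hlam hw hst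
    · refine hball ?_ (show s ∈ Iic (t + 1) from hs1.le)
      rw [Real.dist_eq, abs_lt]
      have := min_le_left (δ / 2) (1 / 2)
      constructor <;> linarith
  have hre0 : 0 < (logOrbit lam t w s).re := (level_pos hw).trans hre
  refine ⟨?_, ?_⟩
  · have h := (hasDerivAt_logOrbit_of_lt hlam hw hs1 hre).cexp
    rw [← field_exp lam s hre0] at h
    exact h
  · rw [norm_orbit]
    exact Real.one_lt_exp_iff.2 hre0

/-- **Exponential growth backward**: `Re logOrbit (s) ≥ log |w| + c_w (t - s)` for `s ≤ t`, with
`c_w = (|w| - 1)/(|w| + 1) > 0`; i.e. `|orbit s| ≥ |w| e^{c_w (t - s)}`. [folklore] -/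
theorem re_logOrbit_ge {s : ℝ} (hs : s ≤ t) :
    Real.log ‖w‖ + (‖w‖ - 1) / (‖w‖ + 1) * (t - s) ≤ (logOrbit lam t w s).re := by
  set c : ℝ := (‖w‖ - 1) / (‖w‖ + 1) with hc
  -- `φ(r) = Re χ(r) + c r` is antitone on `(-∞, t]`
  have hderiv : ∀ r ∈ Iic t, HasDerivWithinAt (fun r ↦ (logOrbit lam t w r).re + c * r)
      ((logField lam r (logOrbit lam t w r)).re + c) (Iic t) r := by
    intro r hr
    have h1 : HasDerivAt (fun r ↦ (logOrbit lam t w r).re) (logField lam r (logOrbit lam t w r)).re r :=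
      Complex.reCLM.hasFDerivAt.comp_hasDerivAt r (hasDerivAt_logOrbit hlam hw hr)
    have h2 : HasDerivAt (fun r : ℝ ↦ c * r) c r := by simpa using (hasDerivAt_id r).const_mul c
    exact (h1.add h2).hasDerivWithinAt
  have hnonpos : ∀ r ∈ interior (Iic t), (logField lam r (logOrbit lam t w r)).re + c ≤ 0 := by
    intro r hr
    have hr' : r ≤ t := mem_Iic.1 (interior_subset hr)
    have hp1 : ‖pTerm lam r (logOrbit lam t w r)‖ < 1 :=
      norm_pTerm_lt_one lam r ((level_pos hw).trans (level_lt_re_logOrbit hlam hw hr'))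
    have hbd := (re_logField_bounds lam r hp1).2
    -- `|p| ≤ 1/|w|`, and `x ↦ (1 - x)/(1 + x)` is decreasing
    have hp : ‖pTerm lam r (logOrbit lam t w r)‖ ≤ ‖w‖⁻¹ := by
      rw [norm_pTerm]
      have := log_norm_le_re_logOrbit hlam hw hr'
      calc Real.exp (-(logOrbit lam t w r).re) ≤ Real.exp (-Real.log ‖w‖) :=
            Real.exp_le_exp.2 (by linarith)
        _ = ‖w‖⁻¹ := by rw [Real.exp_neg, Real.exp_log (by linarith)]
    have hw0 : (0 : ℝ) < ‖w‖ := by linarith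
    have hcle : c ≤ (1 - ‖pTerm lam r (logOrbit lam t w r)‖) / (1 + ‖pTerm lam r (logOrbit lam t w r)‖) := by
      have hx := norm_nonneg (pTerm lam r (logOrbit lam t w r))
      rw [hc, div_le_div_iff₀ (by linarith) (by linarith)]
      have : ‖pTerm lam r (logOrbit lam t w r)‖ * ‖w‖ ≤ 1 := by
        rw [← inv_mul_cancel₀ hw0.ne']; exact mul_le_mul_of_nonneg_right hp hw0.le
      nlinarith
    linarith
  have hanti : AntitoneOn (fun r ↦ (logOrbit lam t w r).re + c * r) (Iic t) :=
    antitoneOn_of_hasDerivWithinAt_nonpos (convex_Iic t)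
      (fun r hr ↦ (hderiv r hr).continuousWithinAt)
      (fun r hr ↦ (hderiv r (interior_subset hr)).mono interior_subset) hnonpos
  have h := hanti (show s ∈ Iic t from mem_Iic.2 hs) (show t ∈ Iic t from self_mem_Iic) hs
  simp only [logOrbit_self hlam hw, Complex.log_re] at h
  linarith

omit hlam in
/-- The growth constant is positive. [folklore] -/
theorem growthConst_pos : 0 < (‖w‖ - 1) / (‖w‖ + 1) := div_pos (by linarith) (by linarith)

/-- **Decay of `p` along the trajectory**: `|p_s| ≤ |w|⁻¹ e^{-c_w (t - s)}` for `s ≤ t`.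
[folklore] -/
theorem norm_pTerm_logOrbit_le {s : ℝ} (hs : s ≤ t) :
    ‖pTerm lam s (logOrbit lam t w s)‖ ≤ ‖w‖⁻¹ * Real.exp (-((‖w‖ - 1) / (‖w‖ + 1) * (t - s))) := by
  have h0 : (0 : ℝ) < ‖w‖ := by linarith
  have hge := re_logOrbit_ge hlam hw hs
  rw [norm_pTerm]
  calc Real.exp (-(logOrbit lam t w s).re)
      ≤ Real.exp (-(Real.log ‖w‖ + (‖w‖ - 1) / (‖w‖ + 1) * (t - s))) := Real.exp_le_exp.2 (by linarith)
    _ = ‖w‖⁻¹ * Real.exp (-((‖w‖ - 1) / (‖w‖ + 1) * (t - s))) := by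
      rw [neg_add, Real.exp_add, Real.exp_neg, Real.exp_log h0]

end Orbit

/-! ### Backward uniqueness and the flow property -/

/-- **Backward uniqueness.** Two solutions of `u̇ = V(s, u)` on `(-∞, t']` staying in
`{|u| ≥ 1 + δ}`, `δ > 0`, with the same value at `t'`, agree on `(-∞, t']`. [folklore] -/
theorem eqOn_of_eq {u₁ u₂ : ℝ → ℂ} {t' : ℝ} {δ : ℝ≥0} (hδ : 0 < δ)
    (hd₁ : ∀ s ≤ t', HasDerivAt u₁ (field lam s (u₁ s)) s)
    (hd₂ : ∀ s ≤ t', HasDerivAt u₂ (field lam s (u₂ s)) s)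
    (hn₁ : ∀ s ≤ t', 1 + (δ : ℝ) ≤ ‖u₁ s‖) (hn₂ : ∀ s ≤ t', 1 + (δ : ℝ) ≤ ‖u₂ s‖)
    (heq : u₁ t' = u₂ t') : ∀ s ≤ t', u₁ s = u₂ s := by
  intro s hs
  have key := ODE_solution_unique_of_mem_Icc_left (v := field lam)
    (s := fun _ ↦ {z : ℂ | 1 + (δ : ℝ) ≤ ‖z‖}) (f := u₁) (g := u₂) (a := s) (b := t')
    (fun r _ ↦ lipschitzOnWith_field lam r hδ)
    (fun r hr ↦ (hd₁ r hr.2).continuousAt.continuousWithinAt)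
    (fun r hr ↦ (hd₁ r hr.2).hasDerivWithinAt) (fun r hr ↦ hn₁ r hr.2)
    (fun r hr ↦ (hd₂ r hr.2).continuousAt.continuousWithinAt)
    (fun r hr ↦ (hd₂ r hr.2).hasDerivWithinAt) (fun r hr ↦ hn₂ r hr.2) heq
  exact key ⟨le_rfl, hs⟩

/-- **The flow property.** For `t' ≤ t` and `w' = orbit t w t'`, the trajectory through `(t', w')`
is the restriction of the trajectory through `(t, w)`: `orbit t' w' s = orbit t w s` for `s ≤ t'`.
[folklore] -/
theorem orbit_orbit (hlam : Continuous lam) {t t' : ℝ} {w : ℂ} (hw : 1 < ‖w‖) (ht' : t' ≤ t) {s : ℝ}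
    (hs : s ≤ t') : orbit lam t' (orbit lam t w t') s = orbit lam t w s := by
  set w' := orbit lam t w t' with hw'def
  have hw' : 1 < ‖w'‖ := one_lt_norm_orbit hlam hw ht'
  set δ : ℝ≥0 := ⟨(‖w‖ - 1) / 2, by linarith⟩ with hδ
  have hδpos : 0 < δ := by change (0 : ℝ) < (‖w‖ - 1) / 2; linarith
  have hδle : 1 + (δ : ℝ) ≤ ‖w‖ := by change 1 + (‖w‖ - 1) / 2 ≤ ‖w‖; linarith
  refine eqOn_of_eq (t' := t') hδpos (fun r hr ↦ hasDerivAt_orbit hlam hw' hr)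
    (fun r hr ↦ hasDerivAt_orbit hlam hw (hr.trans ht'))
    (fun r hr ↦ hδle.trans ((norm_le_norm_orbit hlam hw ht').trans (norm_le_norm_orbit hlam hw' hr)))
    (fun r hr ↦ hδle.trans (norm_le_norm_orbit hlam hw (hr.trans ht'))) ?_ s hs
  rw [orbit_self hlam hw']

/-- **The forward flow property.** If the trajectory through `(t, w)` is a true solution outside
the closed unit disc up to time `t'' ≥ t`, then the trajectory through `(t'', orbit t w t'')`
is again `orbit t w` on `(-∞, t'']`. [folklore] -/
theorem orbit_orbit_of_forward (hlam : Continuous lam) {t t'' : ℝ} {w : ℂ} (hw : 1 < ‖w‖)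
    (htt : t ≤ t'')
    (hsol : ∀ s ≤ t'', HasDerivAt (orbit lam t w) (field lam s (orbit lam t w s)) s ∧
      1 < ‖orbit lam t w s‖) {s : ℝ} (hs : s ≤ t'') :
    orbit lam t'' (orbit lam t w t'') s = orbit lam t w s := by
  set w'' := orbit lam t w t'' with hw''def
  have hw'' : 1 < ‖w''‖ := (hsol t'' le_rfl).2
  -- a uniform margin on `[t, t'']` by compactness, and `≥ |w|` before `t`
  obtain ⟨m, hm1, hm⟩ : ∃ m : ℝ, 1 < m ∧ ∀ r ≤ t'', m ≤ ‖orbit lam t w r‖ := by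
    have hcont : ContinuousOn (fun r ↦ ‖orbit lam t w r‖) (Icc t t'') := fun r hr ↦
      ((hsol r hr.2).1.continuousAt.norm).continuousWithinAt
    obtain ⟨r₀, hr₀, hmin⟩ := (isCompact_Icc (a := t) (b := t'')).exists_isMinOn
      (nonempty_Icc.2 htt) hcont
    refine ⟨min ‖w‖ ‖orbit lam t w r₀‖, lt_min hw (hsol r₀ hr₀.2).2, fun r hr ↦ ?_⟩
    rcases le_or_gt r t with hrt | hrt
    · exact (min_le_left _ _).trans (norm_le_norm_orbit hlam hw hrt)
    · exact (min_le_right _ _).trans (hmin ⟨hrt.le, hr⟩)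
  set δ : ℝ≥0 := ⟨min (m - 1) (‖w''‖ - 1), by
    refine le_min ?_ ?_ <;> linarith⟩ with hδ
  have hδpos : 0 < δ := by
    change (0 : ℝ) < min (m - 1) (‖w''‖ - 1); exact lt_min (by linarith) (by linarith)
  have hδm : 1 + (δ : ℝ) ≤ m := by
    change 1 + min (m - 1) (‖w''‖ - 1) ≤ m; have := min_le_left (m - 1) (‖w''‖ - 1); linarith
  have hδw : 1 + (δ : ℝ) ≤ ‖w''‖ := by
    change 1 + min (m - 1) (‖w''‖ - 1) ≤ ‖w''‖; have := min_le_right (m - 1) (‖w''‖ - 1); linarith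
  refine eqOn_of_eq (t' := t'') hδpos (fun r hr ↦ hasDerivAt_orbit hlam hw'' hr)
    (fun r hr ↦ (hsol r hr).1) (fun r hr ↦ hδw.trans (norm_le_norm_orbit hlam hw'' hr))
    (fun r hr ↦ hδm.trans (hm r hr)) ?_ s hs
  rw [orbit_self hlam hw'']

end WholePlaneLoewner.BackwardFlow

end Literature.Probability.RandomPlanarGeometry
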